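/-
Copyright: b2b-lace packet (literature seat, gen 14).  [FvdH17] §4.2 (4.17): the repulsive TRIANGLE
`𝓣_{j₁,j₂,j₃}(x₁,x₂,x₃) = max_{(i,j)} ℙ_p({0 ←j₁→ x₁}₁ ⊛ {x₁ ←j₂→ x₂}_i ⊛ {x₂ ←j₃→ x₃}_j)` with its lines on up to
three INDEPENDENT configurations, and the extraction bound [NoBLE17-I] (5.41) ("We use the same idea for the
repulsive bubbles, triangles and squares") for EVERY configuration assignment — proved on the product space
`ℙ_p^{⊗k}` (coding → cut at `M` → independence across configurations × BK within, `LabelledDisjointOccurrence`).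
No named fact; no numeral; no dimension.
-/
import Literature.Probability.FitznerVanDerHofstad2017.LabelledDisjointOccurrence
import Literature.Probability.FitznerVanDerHofstad2017.RepulsiveBubbleExtractionIndep
import Literature.Probability.FitznerVanDerHofstad2017.RepulsivePolygonSlots
import HarnessLib

/-!
# [FvdH17] (4.17) / [NoBLE17] (5.41): extraction for the repulsive triangle on independent configurations

[FvdH17] §4.2 (arXiv:1506.07977v2 p. 36 = EJP 22 (2017) no. 43 p. 33), (4.17):
`𝓣_{j₁,j₂,j₃}(x₁,x₂,x₃) = max_{(i,j) ∈ {1,2,3}²} ℙ_p({0 ←j₁→ x₁}₁ ⊛ {x₁ ←j₂→ x₂}_i ⊛ {x₂ ←j₃→ x₃}_j)`, "where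
`ω₁, ω₂, ω₃` are three i.i.d. percolation configurations under `ℙ_p`", and after (4.18): "We use the same idea for the
repulsive bubbles, triangles and squares … More details can be found in [NoBLE17, Section 5.3.2]", whose (5.41)
(PTRF 169 p. 1098) prints, for the same-configuration triangle,
`𝓣_{m₁,m₂,m₃}(x) ≤ Σ_{i=m_{1,3}}^{M−1} a_i(x) μ̄^i Σ_{s₁}Σ_{s₂} 1 + Σ_s (M−m_{2,3}−s)(2dμ̄)^M (D^{⋆M}⋆G)(x)
+ (M−m_{1,3})(2dμ̄)^M (D^{⋆M}⋆G^{⋆2})(x) + (2dμ̄)^M (D^{⋆M}⋆G^{⋆3})(x)`.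
The tree has (5.41) for the SAME-configuration member `diagT` (`RepulsiveTriangleExtraction`, literature seat gen 11)
and, for the members on several configurations, only the simple bound (`pi_real_genDisjConnN_le_prod`, gen 13).
This file proves the extraction bound for EVERY configuration assignment `c : Fin 3 → Fin k` of the three lines —
hence for all nine `(i,j)` members of (4.17) and for their maximum — with the same right-hand side as
`sum_sum_diagT_le_extraction`, and feeds it to the hE-form slot theorem `sum_sum_le_repTriangle_slots`.

## What is proved

* `triLines c m₁ m₂ m₃ v y x` — the three lines `{0 ←m₁→ v}_{c 0}, {v ←m₂→ y}_{c 1}, {y ←m₃→ x}_{c 2}`;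
  `diagTL d k p c m₁ m₂ m₃ v y x = ℙ_p^{⊗k}(⊛ of these)` (so (4.17)'s `(i,j)` member is `c = (0, i−1, j−1)`, `k = 3`)
  and `repTriangle` = the max over `(i,j) ∈ Fin 3 × Fin 3` (as printed).
* CODING (`exists_trail_of_mem_genDisjConnN_triLines`): three pairwise bond-disjoint open vertex-simple paths, living
  on the configurations `c 0, c 1, c 2`, concatenate to ONE bond-avoiding word `W` with junctions `W(r₁) = v`,
  `W(r₂) = y`, `W(L) = x` whose arcs `[0,r₁)`, `[r₁,r₂)`, `[r₂,L)` are open in `ω_{c 0}`, `ω_{c 1}`, `ω_{c 2}`.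
* EXTRACTION (`mem_triEventL_of_trail`) into the index set `idxAllT` of the same-configuration module, with BOX events
  (`triEventL`): for each index, finitely many PIECES (arcs of the explicit word as cylinders `bondsOpen`, `wordOpen`,
  `wordOpenAt`; tails `openConn`), each assigned to the line it sits on, occurring disjointly configuration by
  configuration (`mem_pi_disjointOccurrenceList_of_witnesses`, witnesses = arcs of `W`).
* MEASURE (`pi_real_pi_disjointOccurrenceList_le_prod`: `Measure.pi_pi` × BK): explicit `p^{r₁} p^{r₂−r₁} p^{L−r₂} =
  p^L`, one-tail `≤ p^M τ`, two-tail `≤ p^{M−m₃} p^{m₃} τ τ`, three-tail `≤ p^{M−m₂−m₃} p^{m₂} p^{m₃} τ τ τ` — the same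
  four bounds as for `diagT`; whence **`diagTL_le_extraction`** (pointwise, every `c`), the `(v,y)`-summation stated once
  for any pointwise-dominated `D` (`sum_sum_le_extractionT_of_pointwise`), **`sum_sum_diagTL_le_extraction`**,
  **`sum_sum_repTriangle_le_extraction`** (the max), the binomial-coefficient form and the SLOT form
  **`sum_sum_repTriangle_le_slots`** (module `RepulsivePolygonSlots`' hE discharged for the max).

READING as in `GeneralizedDisjointOccurrence(N)`: PATH READING of `{v ←m→ w}`, bond-disjointness for "disjoint".
Nothing in this module is a cited hypothesis.

## References
* [FvdH17] R. Fitzner, R. van der Hofstad, EJP 22 (2017) no. 43; arXiv:1506.07977v2 — §4.2 Def. 4.1, (4.13)–(4.15),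
  (4.17), (4.18) and the display after it (v2 pp. 35–36 = EJP p. 33).
* [NoBLE17] R. Fitzner, R. van der Hofstad, PTRF 169 (2017) 1041–1119 — §5.3.1 (5.35), §5.3.2 (5.41) p. 1098.
* [Gri99] G. Grimmett, Percolation, 2nd ed., Springer 1999 — §1.4 (1.15), §2.3 (2.17).
-/

noncomputable section

namespace Literature.Probability.FitznerVanDerHofstad2017

open _root_.MeasureTheory Literature.Probability.Percolation
open Literature.Probability.LatticeModels
open Literature.Barriers.CriticalPhenomena
open scoped BigOperators ENNReal

variable {d : ℕ}

/-! ### A. The labelled triangle -/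

/-- The three lines of a member of [FvdH17] (4.17): `{0 ←m₁→ v}` on configuration `c 0`, `{v ←m₂→ y}` on `c 1`,
`{y ←m₃→ x}` on `c 2`. [cite: FitznerVanDerHofstad2017, §4.2 (4.17) (arXiv:1506.07977v2 p. 36 = EJP p. 33)] -/
def triLines {k : ℕ} (c : Fin 3 → Fin k) (m₁ m₂ m₃ : ℕ) (v y x : Site d) : Fin 3 → GDLine (Site d) k :=
  ![⟨m₁, 0, v, c 0⟩, ⟨m₂, v, y, c 1⟩, ⟨m₃, y, x, c 2⟩]

/-- **`𝓣^{(c)}_{m₁,m₂,m₃}(v,y,x) = ℙ_p^{⊗k}({0 ←m₁→ v}_{c₀} ⊛ {v ←m₂→ y}_{c₁} ⊛ {y ←m₃→ x}_{c₂})`** — a member of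
[FvdH17] (4.17) with configuration assignment `c` (real-valued; `Measure.pi` of `k` copies of `ℙ_p`).
[cite: FitznerVanDerHofstad2017, §4.2 (4.17) (arXiv:1506.07977v2 p. 36 = EJP p. 33)] -/
def diagTL (d k : ℕ) (p : unitInterval) (c : Fin 3 → Fin k) (m₁ m₂ m₃ : ℕ) (v y x : Site d) : ℝ :=
  (Measure.pi (fun _ : Fin k => bondPercolation (zdGraph d) p)).real (genDisjConnN (triLines c m₁ m₂ m₃ v y x))

/-- `0 ≤ 𝓣^{(c)}`. [folklore] -/
theorem diagTL_nonneg (k : ℕ) (p : unitInterval) (c : Fin 3 → Fin k) (m₁ m₂ m₃ : ℕ) (v y x : Site d) :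
    0 ≤ diagTL d k p c m₁ m₂ m₃ v y x :=
  measureReal_nonneg

/-- **`𝓣_{m₁,m₂,m₃}(v,y,x) = max_{(i,j) ∈ {1,2,3}²} ℙ_p({0 ←m₁→ v}₁ ⊛ {v ←m₂→ y}_i ⊛ {y ←m₃→ x}_j)`** ([FvdH17]
(4.17), three i.i.d. configurations; `(i,j)` ↦ `c = (0, i, j)` with `0`-based labels).
[cite: FitznerVanDerHofstad2017, §4.2 (4.17) (arXiv:1506.07977v2 p. 36 = EJP p. 33)] -/
def repTriangle (d : ℕ) (p : unitInterval) (m₁ m₂ m₃ : ℕ) (v y x : Site d) : ℝ :=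
  Finset.univ.sup' Finset.univ_nonempty fun ij : Fin 3 × Fin 3 => diagTL d 3 p ![0, ij.1, ij.2] m₁ m₂ m₃ v y x

/-! ### B. Coding on `k` configurations -/

/-- Translating a translated bond: `v + (a + z) = (v + a) + z` on `Sym2`. [folklore] -/
theorem sym2Map_add_add (v a : Site d) (f : Sym2 (Site d)) :
    Sym2.map (fun z => v + z) (Sym2.map (fun z => a + z) f) = Sym2.map (fun z => (v + a) + z) f := by
  rw [Sym2.map_map]
  congr 1
  funext z
  simp only [Function.comp_apply, add_assoc]

/-- **Coding of a labelled triangle member.**  If `ω ∈ {0 ←m₁→ v}_{c₀} ⊛ {v ←m₂→ y}_{c₁} ⊛ {y ←m₃→ x}_{c₂}`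
(lattice configurations), the three pairwise bond-disjoint open vertex-simple paths concatenate to ONE bond-avoiding
word `W` of length `L` with `W(r₁) = v`, `W(r₂) = y`, `W(L) = x` (`m₁ ≤ r₁`, `r₁ + m₂ ≤ r₂`, `r₂ + m₃ ≤ L`), the arc
`[0,r₁)` open in `ω_{c₀}`, `[r₁,r₂)` in `ω_{c₁}`, `[r₂,L)` in `ω_{c₂}`.
[cite: FitznerVanDerHofstad2017, §4.2 Def. 4.1, (4.17) (arXiv:1506.07977v2 pp. 35–36 = EJP p. 33)]
[cite: FitznerVanDerHofstad2016NoBLE, §5.3.1 (5.35) PTRF p. 1097] -/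
theorem exists_trail_of_mem_genDisjConnN_triLines {k : ℕ} {c : Fin 3 → Fin k}
    {ω : Fin k → BondConfig (Site d)} (hω : ∀ j, ω j ⊆ (zdGraph d).edgeSet) {m₁ m₂ m₃ : ℕ} {v y x : Site d}
    (h : ω ∈ genDisjConnN (triLines c m₁ m₂ m₃ v y x)) :
    ∃ (L r₁ r₂ : ℕ) (W : Fin L → Fin d × Bool), IsTrail W ∧ m₁ ≤ r₁ ∧ r₁ + m₂ ≤ r₂ ∧ r₂ + m₃ ≤ L ∧
      wordPos W r₁ = v ∧ wordPos W r₂ = y ∧ wordPos W L = x ∧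
      (↑(wordArc W 0 r₁) : Set (Sym2 (Site d))) ⊆ ω (c 0) ∧ (↑(wordArc W r₁ r₂) : Set (Sym2 (Site d))) ⊆ ω (c 1) ∧
        (↑(wordArc W r₂ L) : Set (Sym2 (Site d))) ⊆ ω (c 2) := by
  classical
  obtain ⟨K, hKω, hKev, hdisj⟩ := h
  have hK0 : K 0 ⊆ ω (c 0) := by simpa [triLines] using hKω 0
  have hK1 : K 1 ⊆ ω (c 1) := by simpa [triLines] using hKω 1
  have hK2 : K 2 ⊆ ω (c 2) := by simpa [triLines] using hKω 2
  obtain ⟨P₀, hP₀, hm₀⟩ : K 0 ∈ openConnGe m₁ (0 : Site d) v := by simpa [triLines, GDLine.event] using hKev 0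
  obtain ⟨P₁, hP₁, hm₁⟩ : K 1 ∈ openConnGe m₂ v y := by simpa [triLines, GDLine.event] using hKev 1
  obtain ⟨P₂, hP₂, hm₂⟩ : K 2 ∈ openConnGe m₃ y x := by simpa [triLines, GDLine.event] using hKev 2
  have hd01 : Disjoint (K 0) (K 1) := hdisj (by decide)
  have hd02 : Disjoint (K 0) (K 2) := hdisj (by decide)
  have hd12 : Disjoint (K 1) (K 2) := hdisj (by decide)
  obtain ⟨u₀, hu₀, hpos₀, hedges₀⟩ := exists_sawWord_prefix (hK0.trans (hω _)) P₀ hP₀ le_rfl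
  obtain ⟨u₁, hu₁, hpos₁, hedges₁⟩ := exists_sawWord_at (hK1.trans (hω _)) P₁ hP₁
  obtain ⟨u₂, hu₂, hpos₂, hedges₂⟩ := exists_sawWord_at (hK2.trans (hω _)) P₂ hP₂
  have hv : wordPos u₀ P₀.length = v := by rw [hpos₀ _ le_rfl, SimpleGraph.Walk.getVert_length]
  have hy : v + wordPos u₁ P₁.length = y := by rw [hpos₁ _ le_rfl, SimpleGraph.Walk.getVert_length]
  have hx : y + wordPos u₂ P₂.length = x := by rw [hpos₂ _ le_rfl, SimpleGraph.Walk.getVert_length]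
  have hmem₀ : ∀ {e : Sym2 (Site d)}, e ∈ wordEdges u₀ → e ∈ K 0 := fun {e} he => hedges₀ (Finset.mem_coe.2 he)
  have hmem₁ : ∀ {f : Sym2 (Site d)}, f ∈ wordEdges u₁ → Sym2.map (fun z => v + z) f ∈ K 1 := fun {f} hf =>
    hedges₁ (by rw [Finset.coe_image]; exact Set.mem_image_of_mem _ (Finset.mem_coe.2 hf))
  have hmem₂ : ∀ {f : Sym2 (Site d)}, f ∈ wordEdges u₂ → Sym2.map (fun z => y + z) f ∈ K 2 := fun {f} hf =>
    hedges₂ (by rw [Finset.coe_image]; exact Set.mem_image_of_mem _ (Finset.mem_coe.2 hf))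
  -- the inner word `u₁ ++ u₂` read from `v`
  have h12 : IsTrail (Fin.append u₁ u₂) := by
    rw [isTrail_append_iff]
    refine ⟨isTrail_of_isSAW hu₁, isTrail_of_isSAW hu₂, ?_⟩
    rw [BondDisjointPair, shiftedWordEdges]
    refine Finset.disjoint_left.2 fun e he₁ he₂ => ?_
    rw [Finset.mem_image] at he₂
    obtain ⟨f, hf, rfl⟩ := he₂
    have h1 := hmem₁ he₁
    rw [sym2Map_add_add, hy] at h1
    exact Set.disjoint_left.1 hd12 h1 (hmem₂ hf)
  -- bonds of `u₁ ++ u₂`, translated to `v`, lie in `K 1 ∪ K 2`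
  have hmem₁₂ : ∀ {g : Sym2 (Site d)}, g ∈ wordEdges (Fin.append u₁ u₂) →
      Sym2.map (fun z => v + z) g ∈ K 1 ∨ Sym2.map (fun z => v + z) g ∈ K 2 := by
    intro g hg
    have hg' := wordEdges_append_subset u₁ u₂ hg
    rw [Finset.mem_union] at hg'
    rcases hg' with hg' | hg'
    · exact Or.inl (hmem₁ hg')
    · rw [shiftedWordEdges, Finset.mem_image] at hg'
      obtain ⟨f, hf, rfl⟩ := hg'
      rw [sym2Map_add_add, hy]
      exact Or.inr (hmem₂ hf)
  refine ⟨P₀.length + (P₁.length + P₂.length), P₀.length, P₀.length + P₁.length,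
    Fin.append u₀ (Fin.append u₁ u₂), ?_, hm₀, by omega, by omega, ?_, ?_, ?_, ?_, ?_, ?_⟩
  · rw [isTrail_append_iff]
    refine ⟨isTrail_of_isSAW hu₀, h12, ?_⟩
    rw [BondDisjointPair, shiftedWordEdges, hv]
    refine Finset.disjoint_left.2 fun e he₀ he' => ?_
    rw [Finset.mem_image] at he'
    obtain ⟨g, hg, rfl⟩ := he'
    rcases hmem₁₂ hg with h1 | h2
    · exact Set.disjoint_left.1 hd01 (hmem₀ he₀) h1
    · exact Set.disjoint_left.1 hd02 (hmem₀ he₀) h2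
  · rw [wordPos_append_of_le u₀ _ le_rfl, hv]
  · rw [wordPos_append_add u₀ _ (by omega : P₁.length ≤ P₁.length + P₂.length), hv,
      wordPos_append_of_le u₁ u₂ le_rfl, hy]
  · rw [wordPos_append_add u₀ _ le_rfl, hv, wordPos_append_add u₁ u₂ le_rfl, ← add_assoc, hy, hx]
  · intro e he
    rw [Finset.mem_coe, wordArc, Finset.mem_image] at he
    obtain ⟨i, hi, rfl⟩ := he
    rw [Finset.mem_Ico] at hi
    rw [wordEdge_append_of_lt u₀ _ hi.2]
    exact hK0 (hmem₀ (Finset.mem_image.2 ⟨i, Finset.mem_range.2 hi.2, rfl⟩))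
  · intro e he
    rw [Finset.mem_coe, wordArc, Finset.mem_image] at he
    obtain ⟨i, hi, rfl⟩ := he
    rw [Finset.mem_Ico] at hi
    obtain ⟨j, rfl⟩ := Nat.exists_eq_add_of_le hi.1
    rw [wordEdge_append_add u₀ _ (by omega : j < P₁.length + P₂.length), hv,
      wordEdge_append_of_lt u₁ u₂ (by omega : j < P₁.length)]
    exact hK1 (hmem₁ (Finset.mem_image.2 ⟨j, Finset.mem_range.2 (by omega), rfl⟩))
  · intro e he
    rw [Finset.mem_coe, wordArc, Finset.mem_image] at he
    obtain ⟨i, hi, rfl⟩ := he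
    rw [Finset.mem_Ico] at hi
    obtain ⟨j, rfl⟩ := Nat.exists_eq_add_of_le hi.1
    rw [show P₀.length + P₁.length + j = P₀.length + (P₁.length + j) from add_assoc _ _ _,
      wordEdge_append_add u₀ _ (by omega : P₁.length + j < P₁.length + P₂.length), hv,
      wordEdge_append_add u₁ u₂ (by omega : j < P₂.length), sym2Map_add_add, hy]
    exact hK2 (hmem₂ (Finset.mem_image.2 ⟨j, Finset.mem_range.2 (by omega), rfl⟩))

/-- Consecutive arcs of a trail along a non-decreasing sequence of cut points `t₀ ≤ t₁ ≤ ⋯ ≤ t_q ≤ N` are pairwise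
bond-disjoint. [folklore] -/
theorem pairwise_disjoint_wordArc_cuts {N q : ℕ} {W : Fin N → Fin d × Bool} (hW : IsTrail W)
    (t : Fin (q + 1) → ℕ) (ht : ∀ i : Fin q, t i.castSucc ≤ t i.succ) (hN : t (Fin.last q) ≤ N) :
    Pairwise fun i j : Fin q =>
      Disjoint (↑(wordArc W (t i.castSucc) (t i.succ)) : Set (Sym2 (Site d))) ↑(wordArc W (t j.castSucc) (t j.succ)) := by
  have hmono : Monotone t := Fin.monotone_iff_le_succ.2 ht
  have hle : ∀ {i j : Fin q}, i < j → t i.succ ≤ t j.castSucc := fun {i j} h =>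
    hmono (Fin.le_iff_val_le_val.2 (by
      have h' : (i : ℕ) < j := h
      simp only [Fin.val_succ, Fin.val_castSucc]
      omega))
  have hlast : ∀ j : Fin q, t j.succ ≤ N := fun j => (hmono (Fin.le_last _)).trans hN
  intro i j hij
  rcases lt_or_gt_of_ne hij with h | h
  · exact disjoint_wordArc hW (hle h) (hlast j)
  · exact (disjoint_wordArc hW (hle h) (hlast i)).symm

/-- Sub-arcs: `[a', b') ⊆ [a, b)` ⇒ `wordArc W a' b' ⊆ wordArc W a b`. [folklore] -/
theorem wordArc_sub {N : ℕ} (W : Fin N → Fin d × Bool) {a a' b' b : ℕ} (ha : a ≤ a') (hb : b' ≤ b) :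
    wordArc W a' b' ⊆ wordArc W a b :=
  (wordArc_anti_left W ha b').trans (wordArc_mono_right W a hb)

/-! ### C. The extraction events: boxes of labelled pieces -/

section Pieces

variable {k : ℕ}

/-- The BOX of labelled pieces: on each configuration `c'`, the pieces `A_j` sitting on a line with `c (lab j) = c'`
occur bond-disjointly. [cite: FitznerVanDerHofstad2017, §4.2 Def. 4.1, remark after (4.13) (arXiv:1506.07977v2 p. 35)] -/
def boxOf {q : ℕ} (A : Fin q → Set (BondConfig (Site d))) (lab : Fin q → Fin 3) (c : Fin 3 → Fin k) :
    Set (Fin k → BondConfig (Site d)) :=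
  Set.pi Set.univ fun c' => disjointOccurrenceList (eventsAt A (c ∘ lab) c')

/-- Explicit family: the three arcs `[0,r₁)`, `[r₁,r₂)`, `[r₂,L)` of `W` as cylinders. [folklore] -/
def piecesE {L : ℕ} (W : Fin L → Fin d × Bool) (r₁ r₂ : ℕ) : Fin 3 → Set (BondConfig (Site d)) :=
  ![bondsOpen (wordArc W 0 r₁), bondsOpen (wordArc W r₁ r₂), bondsOpen (wordArc W r₂ L)]

/-- One-tail family: the arcs `[0,r₁)`, `[r₁,r₂)`, `[r₂,M)` of `u` and the tail `{u(M) ↔ x}`. [folklore] -/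
def piecesO {M : ℕ} (u : Fin M → Fin d × Bool) (r₁ r₂ : ℕ) (x : Site d) : Fin 4 → Set (BondConfig (Site d)) :=
  ![bondsOpen (wordArc u 0 r₁), bondsOpen (wordArc u r₁ r₂), bondsOpen (wordArc u r₂ M), openConn (wordPos u M) x]

/-- Two-tail family: arcs `[0,r₁)`, `[r₁,M−m₃)` of `u₁`, tail `{u₁(M−m₃) ↔ y}`, cylinder of `u₃` at `y`, tail
`{y + u₃(m₃) ↔ x}`. [folklore] -/
def piecesT2 {M m₃ : ℕ} (u₁ : Fin (M - m₃) → Fin d × Bool) (r₁ : ℕ) (u₃ : Fin m₃ → Fin d × Bool) (x y : Site d) :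
    Fin 5 → Set (BondConfig (Site d)) :=
  ![bondsOpen (wordArc u₁ 0 r₁), bondsOpen (wordArc u₁ r₁ (M - m₃)), openConn (wordPos u₁ (M - m₃)) y,
    wordOpenAt y u₃, openConn (y + wordPos u₃ m₃) x]

/-- Three-tail family: cylinder of `u₁`, tail to `v`, cylinder of `u₂` at `v`, tail to `y`, cylinder of `u₃` at `y`,
tail to `x`. [folklore] -/
def piecesT3 {M m₂ m₃ : ℕ} (u₁ : Fin (M - (m₂ + m₃)) → Fin d × Bool) (u₂ : Fin m₂ → Fin d × Bool)
    (u₃ : Fin m₃ → Fin d × Bool) (x v y : Site d) : Fin 6 → Set (BondConfig (Site d)) :=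
  ![wordOpen u₁, openConn (wordPos u₁ (M - (m₂ + m₃))) v, wordOpenAt v u₂, openConn (v + wordPos u₂ m₂) y,
    wordOpenAt y u₃, openConn (y + wordPos u₃ m₃) x]

/-- Lines of the explicit pieces. [folklore] -/
def labE : Fin 3 → Fin 3 := ![0, 1, 2]
/-- Lines of the one-tail pieces. [folklore] -/
def labO : Fin 4 → Fin 3 := ![0, 1, 2, 2]
/-- Lines of the two-tail pieces. [folklore] -/
def labT2 : Fin 5 → Fin 3 := ![0, 1, 1, 2, 2]
/-- Lines of the three-tail pieces. [folklore] -/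
def labT3 : Fin 6 → Fin 3 := ![0, 0, 1, 1, 2, 2]

/-- The product-space event attached to an index of the triangle extraction (labelled version of `triEvent`).
[folklore] -/
def triEventL (c : Fin 3 → Fin k) (m₂ m₃ M : ℕ) (x v y : Site d) :
    TriIdx d m₂ m₃ M → Set (Fin k → BondConfig (Site d))
  | Sum.inl ⟨_, (W, r₁, r₂)⟩ => boxOf (piecesE W r₁ r₂) labE c
  | Sum.inr (Sum.inl (u, r₁, r₂)) => boxOf (piecesO u r₁ r₂ x) labO c
  | Sum.inr (Sum.inr (Sum.inl ((u₁, r₁), u₃))) => boxOf (piecesT2 u₁ r₁ u₃ x y) labT2 c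
  | Sum.inr (Sum.inr (Sum.inr (u₁, u₂, u₃))) => boxOf (piecesT3 u₁ u₂ u₃ x v y) labT3 c

/-- The explicit pieces are increasing events. [folklore] -/
theorem piecesE_upper {L : ℕ} (W : Fin L → Fin d × Bool) (r₁ r₂ : ℕ) : ∀ j, IsUpperSet (piecesE W r₁ r₂ j) := by
  intro j
  fin_cases j
  exacts [isUpperSet_bondsOpen _, isUpperSet_bondsOpen _, isUpperSet_bondsOpen _]

/-- The explicit pieces are finitary events. [folklore] -/
theorem piecesE_finitary {L : ℕ} (W : Fin L → Fin d × Bool) (r₁ r₂ : ℕ) : ∀ j, IsFinitary (piecesE W r₁ r₂ j) := by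
  intro j
  fin_cases j
  exacts [isFinitary_bondsOpen _, isFinitary_bondsOpen _, isFinitary_bondsOpen _]

/-- The one-tail pieces are increasing events. [folklore] -/
theorem piecesO_upper {M : ℕ} (u : Fin M → Fin d × Bool) (r₁ r₂ : ℕ) (x : Site d) :
    ∀ j, IsUpperSet (piecesO u r₁ r₂ x j) := by
  intro j
  fin_cases j
  exacts [isUpperSet_bondsOpen _, isUpperSet_bondsOpen _, isUpperSet_bondsOpen _, isUpperSet_openConn _ _]

/-- The one-tail pieces are finitary events. [folklore] -/
theorem piecesO_finitary {M : ℕ} (u : Fin M → Fin d × Bool) (r₁ r₂ : ℕ) (x : Site d) :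
    ∀ j, IsFinitary (piecesO u r₁ r₂ x j) := by
  classical
  intro j
  fin_cases j
  exacts [isFinitary_bondsOpen _, isFinitary_bondsOpen _, isFinitary_bondsOpen _, isFinitary_openConn _ _]

/-- The two-tail pieces are increasing events. [folklore] -/
theorem piecesT2_upper {M m₃ : ℕ} (u₁ : Fin (M - m₃) → Fin d × Bool) (r₁ : ℕ) (u₃ : Fin m₃ → Fin d × Bool)
    (x y : Site d) : ∀ j, IsUpperSet (piecesT2 u₁ r₁ u₃ x y j) := by
  intro j
  fin_cases j
  exacts [isUpperSet_bondsOpen _, isUpperSet_bondsOpen _, isUpperSet_openConn _ _, isUpperSet_wordOpenAt _ _,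
    isUpperSet_openConn _ _]

/-- The two-tail pieces are finitary events. [folklore] -/
theorem piecesT2_finitary {M m₃ : ℕ} (u₁ : Fin (M - m₃) → Fin d × Bool) (r₁ : ℕ) (u₃ : Fin m₃ → Fin d × Bool)
    (x y : Site d) : ∀ j, IsFinitary (piecesT2 u₁ r₁ u₃ x y j) := by
  classical
  intro j
  fin_cases j
  exacts [isFinitary_bondsOpen _, isFinitary_bondsOpen _, isFinitary_openConn _ _, isFinitary_wordOpenAt _ _,
    isFinitary_openConn _ _]

/-- The three-tail pieces are increasing events. [folklore] -/
theorem piecesT3_upper {M m₂ m₃ : ℕ} (u₁ : Fin (M - (m₂ + m₃)) → Fin d × Bool) (u₂ : Fin m₂ → Fin d × Bool)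
    (u₃ : Fin m₃ → Fin d × Bool) (x v y : Site d) : ∀ j, IsUpperSet (piecesT3 u₁ u₂ u₃ x v y j) := by
  intro j
  fin_cases j
  exacts [isUpperSet_wordOpen _, isUpperSet_openConn _ _, isUpperSet_wordOpenAt _ _, isUpperSet_openConn _ _,
    isUpperSet_wordOpenAt _ _, isUpperSet_openConn _ _]

/-- The three-tail pieces are finitary events. [folklore] -/
theorem piecesT3_finitary {M m₂ m₃ : ℕ} (u₁ : Fin (M - (m₂ + m₃)) → Fin d × Bool) (u₂ : Fin m₂ → Fin d × Bool)
    (u₃ : Fin m₃ → Fin d × Bool) (x v y : Site d) : ∀ j, IsFinitary (piecesT3 u₁ u₂ u₃ x v y j) := by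
  classical
  intro j
  fin_cases j
  exacts [isFinitary_wordOpen _, isFinitary_openConn _ _, isFinitary_wordOpenAt _ _, isFinitary_openConn _ _,
    isFinitary_wordOpenAt _ _, isFinitary_openConn _ _]

end Pieces

/-! ### D. Extraction: an open labelled trail lies in one of the boxes -/

section Extraction

variable {k : ℕ} (c : Fin 3 → Fin k)

/-- **Explicit piece**: `L < M`. [cite: FitznerVanDerHofstad2016NoBLE, §5.3.2 (5.41) PTRF p. 1098] -/
theorem mem_boxE_of_trail {ω : Fin k → BondConfig (Site d)} {L r₁ r₂ : ℕ} {W : Fin L → Fin d × Bool}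
    (hW : IsTrail W) (hr₁₂ : r₁ ≤ r₂) (hr₂L : r₂ ≤ L)
    (h0 : (↑(wordArc W 0 r₁) : Set (Sym2 (Site d))) ⊆ ω (c 0))
    (h1 : (↑(wordArc W r₁ r₂) : Set (Sym2 (Site d))) ⊆ ω (c 1))
    (h2 : (↑(wordArc W r₂ L) : Set (Sym2 (Site d))) ⊆ ω (c 2)) :
    ω ∈ boxOf (piecesE W r₁ r₂) labE c := by
  let t : Fin 4 → ℕ := ![0, r₁, r₂, L]
  refine mem_pi_disjointOccurrenceList_of_witnesses (piecesE W r₁ r₂) (c ∘ labE) (piecesE_upper W r₁ r₂)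
    (fun j => (↑(wordArc W (t j.castSucc) (t j.succ)) : Set (Sym2 (Site d)))) ?_ ?_
    (pairwise_disjoint_wordArc_cuts hW t ?_ le_rfl)
  · intro j
    fin_cases j
    · exact h0
    · exact h1
    · exact h2
  · intro j
    fin_cases j
    · show (↑(wordArc W 0 r₁) : Set (Sym2 (Site d))) ∈ bondsOpen (wordArc W 0 r₁)
      exact (mem_bondsOpen _ _).2 subset_rfl
    · show (↑(wordArc W r₁ r₂) : Set (Sym2 (Site d))) ∈ bondsOpen (wordArc W r₁ r₂)
      exact (mem_bondsOpen _ _).2 subset_rfl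
    · show (↑(wordArc W r₂ L) : Set (Sym2 (Site d))) ∈ bondsOpen (wordArc W r₂ L)
      exact (mem_bondsOpen _ _).2 subset_rfl
  · intro i
    fin_cases i
    · show 0 ≤ r₁
      exact Nat.zero_le _
    · show r₁ ≤ r₂
      exact hr₁₂
    · show r₂ ≤ L
      exact hr₂L

/-- **One-tail piece**: `M ≤ L`, `r₂ ≤ M`: the arcs `[0,r₁)`, `[r₁,r₂)`, `[r₂,M)` of `u = W|[0,M)` and the tail
`W(M) → x` (arc `[M,L)`). [cite: FitznerVanDerHofstad2016NoBLE, §5.3.2 (5.41) PTRF p. 1098] -/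
theorem mem_boxO_of_trail {ω : Fin k → BondConfig (Site d)} {L M r₁ r₂ : ℕ} {x : Site d} {W : Fin L → Fin d × Bool}
    (hW : IsTrail W) (hLM : M ≤ L) (hr₁₂ : r₁ ≤ r₂) (hr₂M : r₂ ≤ M) (hx : wordPos W L = x)
    (h0 : (↑(wordArc W 0 r₁) : Set (Sym2 (Site d))) ⊆ ω (c 0))
    (h1 : (↑(wordArc W r₁ r₂) : Set (Sym2 (Site d))) ⊆ ω (c 1))
    (h2 : (↑(wordArc W r₂ L) : Set (Sym2 (Site d))) ⊆ ω (c 2)) :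
    ω ∈ boxOf (piecesO (wordTake W M hLM) r₁ r₂ x) labO c := by
  let t : Fin 5 → ℕ := ![0, r₁, r₂, M, L]
  refine mem_pi_disjointOccurrenceList_of_witnesses (piecesO (wordTake W M hLM) r₁ r₂ x) (c ∘ labO)
    (piecesO_upper _ r₁ r₂ x) (fun j => (↑(wordArc W (t j.castSucc) (t j.succ)) : Set (Sym2 (Site d)))) ?_ ?_
    (pairwise_disjoint_wordArc_cuts hW t ?_ le_rfl)
  · intro j
    fin_cases j
    · exact h0
    · exact h1
    · show (↑(wordArc W r₂ M) : Set (Sym2 (Site d))) ⊆ ω (c 2)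
      exact (Finset.coe_subset.2 (wordArc_sub W le_rfl hLM)).trans h2
    · show (↑(wordArc W M L) : Set (Sym2 (Site d))) ⊆ ω (c 2)
      exact (Finset.coe_subset.2 (wordArc_sub W hr₂M le_rfl)).trans h2
  · intro j
    fin_cases j
    · show (↑(wordArc W 0 r₁) : Set (Sym2 (Site d))) ∈ bondsOpen (wordArc (wordTake W M hLM) 0 r₁)
      rw [mem_bondsOpen, wordArc_wordTake W hLM (hr₁₂.trans hr₂M)]
    · show (↑(wordArc W r₁ r₂) : Set (Sym2 (Site d))) ∈ bondsOpen (wordArc (wordTake W M hLM) r₁ r₂)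
      rw [mem_bondsOpen, wordArc_wordTake W hLM hr₂M]
    · show (↑(wordArc W r₂ M) : Set (Sym2 (Site d))) ∈ bondsOpen (wordArc (wordTake W M hLM) r₂ M)
      rw [mem_bondsOpen, wordArc_wordTake W hLM le_rfl]
    · show (↑(wordArc W M L) : Set (Sym2 (Site d))) ∈ openConn (wordPos (wordTake W M hLM) M) x
      rw [wordPos_wordTake W hLM le_rfl, ← hx]
      exact wordArc_mem_openConn W hLM le_rfl
  · intro i
    fin_cases i
    · show 0 ≤ r₁
      exact Nat.zero_le _
    · show r₁ ≤ r₂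
      exact hr₁₂
    · show r₂ ≤ M
      exact hr₂M
    · show M ≤ L
      exact hLM

/-- **Two-tail piece**: `M − m₃ ≤ r₂`, `r₁ ≤ M − m₃`, `r₂ + m₃ ≤ L`: arcs `[0,r₁)`, `[r₁,M−m₃)` of `u₁ = W|[0,M−m₃)`,
the tail `W(M−m₃) → y` (arc `[M−m₃,r₂)`), the `m₃` bonds after `y`, the tail `W(r₂+m₃) → x`.
[cite: FitznerVanDerHofstad2016NoBLE, §5.3.2 (5.41) PTRF p. 1098] -/
theorem mem_boxT2_of_trail {ω : Fin k → BondConfig (Site d)} {L M m₃ r₁ r₂ : ℕ} {y x : Site d}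
    {W : Fin L → Fin d × Bool} (hW : IsTrail W) (hr₁M : r₁ ≤ M - m₃) (hMr₂ : M - m₃ ≤ r₂) (hr₂L : r₂ + m₃ ≤ L)
    (hML : M - m₃ ≤ L) (hy : wordPos W r₂ = y) (hx : wordPos W L = x)
    (h0 : (↑(wordArc W 0 r₁) : Set (Sym2 (Site d))) ⊆ ω (c 0))
    (h1 : (↑(wordArc W r₁ r₂) : Set (Sym2 (Site d))) ⊆ ω (c 1))
    (h2 : (↑(wordArc W r₂ L) : Set (Sym2 (Site d))) ⊆ ω (c 2)) :
    ω ∈ boxOf (piecesT2 (wordTake W (M - m₃) hML) r₁ (wordSeg W r₂ m₃ hr₂L) x y) labT2 c := by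
  have hp₁ : wordPos (wordTake W (M - m₃) hML) (M - m₃) = wordPos W (M - m₃) := wordPos_wordTake W hML le_rfl
  have hp₃ : y + wordPos (wordSeg W r₂ m₃ hr₂L) m₃ = wordPos W (r₂ + m₃) := by
    rw [← hy, wordPos_wordSeg W hr₂L le_rfl]
  have hW₃ : (wordEdges (wordSeg W r₂ m₃ hr₂L)).image (Sym2.map fun z => y + z) = wordArc W r₂ (r₂ + m₃) := by
    rw [← hy, image_wordEdges_wordSeg W hr₂L]
  let t : Fin 6 → ℕ := ![0, r₁, M - m₃, r₂, r₂ + m₃, L]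
  refine mem_pi_disjointOccurrenceList_of_witnesses _ (c ∘ labT2) (piecesT2_upper _ r₁ _ x y)
    (fun j => (↑(wordArc W (t j.castSucc) (t j.succ)) : Set (Sym2 (Site d)))) ?_ ?_
    (pairwise_disjoint_wordArc_cuts hW t ?_ le_rfl)
  · intro j
    fin_cases j
    · exact h0
    · show (↑(wordArc W r₁ (M - m₃)) : Set (Sym2 (Site d))) ⊆ ω (c 1)
      exact (Finset.coe_subset.2 (wordArc_sub W le_rfl hMr₂)).trans h1
    · show (↑(wordArc W (M - m₃) r₂) : Set (Sym2 (Site d))) ⊆ ω (c 1)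
      exact (Finset.coe_subset.2 (wordArc_sub W hr₁M le_rfl)).trans h1
    · show (↑(wordArc W r₂ (r₂ + m₃)) : Set (Sym2 (Site d))) ⊆ ω (c 2)
      exact (Finset.coe_subset.2 (wordArc_sub W le_rfl (by omega))).trans h2
    · show (↑(wordArc W (r₂ + m₃) L) : Set (Sym2 (Site d))) ⊆ ω (c 2)
      exact (Finset.coe_subset.2 (wordArc_sub W (by omega) le_rfl)).trans h2
  · intro j
    fin_cases j
    · show (↑(wordArc W 0 r₁) : Set (Sym2 (Site d))) ∈ bondsOpen (wordArc (wordTake W (M - m₃) hML) 0 r₁)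
      rw [mem_bondsOpen, wordArc_wordTake W hML hr₁M]
    · show (↑(wordArc W r₁ (M - m₃)) : Set (Sym2 (Site d))) ∈
        bondsOpen (wordArc (wordTake W (M - m₃) hML) r₁ (M - m₃))
      rw [mem_bondsOpen, wordArc_wordTake W hML le_rfl]
    · show (↑(wordArc W (M - m₃) r₂) : Set (Sym2 (Site d))) ∈ openConn (wordPos (wordTake W (M - m₃) hML) (M - m₃)) y
      rw [hp₁, ← hy]
      exact wordArc_mem_openConn W hMr₂ (by omega)
    · show (↑(wordArc W r₂ (r₂ + m₃)) : Set (Sym2 (Site d))) ∈ wordOpenAt y (wordSeg W r₂ m₃ hr₂L)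
      rw [mem_wordOpenAt, hW₃]
    · show (↑(wordArc W (r₂ + m₃) L) : Set (Sym2 (Site d))) ∈ openConn (y + wordPos (wordSeg W r₂ m₃ hr₂L) m₃) x
      rw [hp₃, ← hx]
      exact wordArc_mem_openConn W hr₂L le_rfl
  · intro i
    fin_cases i
    · show 0 ≤ r₁
      exact Nat.zero_le _
    · show r₁ ≤ M - m₃
      exact hr₁M
    · show M - m₃ ≤ r₂
      exact hMr₂
    · show r₂ ≤ r₂ + m₃
      exact Nat.le_add_right _ _
    · show r₂ + m₃ ≤ L
      exact hr₂L

/-- **Three-tail piece**: `M − m₂ − m₃ ≤ r₁`, `r₁ + m₂ ≤ r₂`, `r₂ + m₃ ≤ L` (six arcs of `W`, two per line).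
[cite: FitznerVanDerHofstad2016NoBLE, §5.3.2 (5.41) PTRF p. 1098] -/
theorem mem_boxT3_of_trail {ω : Fin k → BondConfig (Site d)} {L M m₂ m₃ r₁ r₂ : ℕ} {v y x : Site d}
    {W : Fin L → Fin d × Bool} (hW : IsTrail W) (hMr : M - (m₂ + m₃) ≤ r₁) (hr₁₂ : r₁ + m₂ ≤ r₂)
    (hr₂L : r₂ + m₃ ≤ L) (hML : M - (m₂ + m₃) ≤ L) (hr₁L : r₁ + m₂ ≤ L)
    (hv : wordPos W r₁ = v) (hy : wordPos W r₂ = y) (hx : wordPos W L = x)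
    (h0 : (↑(wordArc W 0 r₁) : Set (Sym2 (Site d))) ⊆ ω (c 0))
    (h1 : (↑(wordArc W r₁ r₂) : Set (Sym2 (Site d))) ⊆ ω (c 1))
    (h2 : (↑(wordArc W r₂ L) : Set (Sym2 (Site d))) ⊆ ω (c 2)) :
    ω ∈ boxOf (piecesT3 (wordTake W (M - (m₂ + m₃)) hML) (wordSeg W r₁ m₂ hr₁L) (wordSeg W r₂ m₃ hr₂L) x v y)
      labT3 c := by
  have hp₁ : wordPos (wordTake W (M - (m₂ + m₃)) hML) (M - (m₂ + m₃)) = wordPos W (M - (m₂ + m₃)) :=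
    wordPos_wordTake W hML le_rfl
  have hp₂ : v + wordPos (wordSeg W r₁ m₂ hr₁L) m₂ = wordPos W (r₁ + m₂) := by
    rw [← hv, wordPos_wordSeg W hr₁L le_rfl]
  have hp₃ : y + wordPos (wordSeg W r₂ m₃ hr₂L) m₃ = wordPos W (r₂ + m₃) := by
    rw [← hy, wordPos_wordSeg W hr₂L le_rfl]
  have hW₁ : wordEdges (wordTake W (M - (m₂ + m₃)) hML) = wordArc W 0 (M - (m₂ + m₃)) := wordEdges_wordTake W hML
  have hW₂ : (wordEdges (wordSeg W r₁ m₂ hr₁L)).image (Sym2.map fun z => v + z) = wordArc W r₁ (r₁ + m₂) := by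
    rw [← hv, image_wordEdges_wordSeg W hr₁L]
  have hW₃ : (wordEdges (wordSeg W r₂ m₃ hr₂L)).image (Sym2.map fun z => y + z) = wordArc W r₂ (r₂ + m₃) := by
    rw [← hy, image_wordEdges_wordSeg W hr₂L]
  let t : Fin 7 → ℕ := ![0, M - (m₂ + m₃), r₁, r₁ + m₂, r₂, r₂ + m₃, L]
  refine mem_pi_disjointOccurrenceList_of_witnesses _ (c ∘ labT3) (piecesT3_upper _ _ _ x v y)
    (fun j => (↑(wordArc W (t j.castSucc) (t j.succ)) : Set (Sym2 (Site d)))) ?_ ?_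
    (pairwise_disjoint_wordArc_cuts hW t ?_ le_rfl)
  · intro j
    fin_cases j
    · show (↑(wordArc W 0 (M - (m₂ + m₃))) : Set (Sym2 (Site d))) ⊆ ω (c 0)
      exact (Finset.coe_subset.2 (wordArc_sub W le_rfl hMr)).trans h0
    · show (↑(wordArc W (M - (m₂ + m₃)) r₁) : Set (Sym2 (Site d))) ⊆ ω (c 0)
      exact (Finset.coe_subset.2 (wordArc_sub W (Nat.zero_le _) le_rfl)).trans h0
    · show (↑(wordArc W r₁ (r₁ + m₂)) : Set (Sym2 (Site d))) ⊆ ω (c 1)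
      exact (Finset.coe_subset.2 (wordArc_sub W le_rfl hr₁₂)).trans h1
    · show (↑(wordArc W (r₁ + m₂) r₂) : Set (Sym2 (Site d))) ⊆ ω (c 1)
      exact (Finset.coe_subset.2 (wordArc_sub W (Nat.le_add_right _ _) le_rfl)).trans h1
    · show (↑(wordArc W r₂ (r₂ + m₃)) : Set (Sym2 (Site d))) ⊆ ω (c 2)
      exact (Finset.coe_subset.2 (wordArc_sub W le_rfl hr₂L)).trans h2
    · show (↑(wordArc W (r₂ + m₃) L) : Set (Sym2 (Site d))) ⊆ ω (c 2)
      exact (Finset.coe_subset.2 (wordArc_sub W (Nat.le_add_right _ _) le_rfl)).trans h2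
  · intro j
    fin_cases j
    · show (↑(wordArc W 0 (M - (m₂ + m₃))) : Set (Sym2 (Site d))) ∈ wordOpen (wordTake W (M - (m₂ + m₃)) hML)
      rw [mem_wordOpen, hW₁]
    · show (↑(wordArc W (M - (m₂ + m₃)) r₁) : Set (Sym2 (Site d))) ∈
        openConn (wordPos (wordTake W (M - (m₂ + m₃)) hML) (M - (m₂ + m₃))) v
      rw [hp₁, ← hv]
      exact wordArc_mem_openConn W hMr (by omega)
    · show (↑(wordArc W r₁ (r₁ + m₂)) : Set (Sym2 (Site d))) ∈ wordOpenAt v (wordSeg W r₁ m₂ hr₁L)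
      rw [mem_wordOpenAt, hW₂]
    · show (↑(wordArc W (r₁ + m₂) r₂) : Set (Sym2 (Site d))) ∈ openConn (v + wordPos (wordSeg W r₁ m₂ hr₁L) m₂) y
      rw [hp₂, ← hy]
      exact wordArc_mem_openConn W hr₁₂ (by omega)
    · show (↑(wordArc W r₂ (r₂ + m₃)) : Set (Sym2 (Site d))) ∈ wordOpenAt y (wordSeg W r₂ m₃ hr₂L)
      rw [mem_wordOpenAt, hW₃]
    · show (↑(wordArc W (r₂ + m₃) L) : Set (Sym2 (Site d))) ∈ openConn (y + wordPos (wordSeg W r₂ m₃ hr₂L) m₃) x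
      rw [hp₃, ← hx]
      exact wordArc_mem_openConn W hr₂L le_rfl
  · intro i
    fin_cases i
    · show 0 ≤ M - (m₂ + m₃)
      exact Nat.zero_le _
    · show M - (m₂ + m₃) ≤ r₁
      exact hMr
    · show r₁ ≤ r₁ + m₂
      exact Nat.le_add_right _ _
    · show r₁ + m₂ ≤ r₂
      exact hr₁₂
    · show r₂ ≤ r₂ + m₃
      exact Nat.le_add_right _ _
    · show r₂ + m₃ ≤ L
      exact hr₂L

/-- **Extraction on `k` configurations** (four cases, as `mem_triEvent_of_trail`).
[cite: FitznerVanDerHofstad2016NoBLE, §5.3.2 (5.41) PTRF p. 1098]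
[cite: FitznerVanDerHofstad2017, §4.2 (4.17) and the display after (4.18) (arXiv:1506.07977v2 p. 36 = EJP p. 33)] -/
theorem mem_triEventL_of_trail (m₁ m₂ m₃ M : ℕ) {ω : Fin k → BondConfig (Site d)} {L r₁ r₂ : ℕ} {v y x : Site d}
    {W : Fin L → Fin d × Bool} (hW : IsTrail W) (hr₁ : m₁ ≤ r₁) (hr₁₂ : r₁ + m₂ ≤ r₂) (hr₂L : r₂ + m₃ ≤ L)
    (hv : wordPos W r₁ = v) (hy : wordPos W r₂ = y) (hx : wordPos W L = x)
    (h0 : (↑(wordArc W 0 r₁) : Set (Sym2 (Site d))) ⊆ ω (c 0))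
    (h1 : (↑(wordArc W r₁ r₂) : Set (Sym2 (Site d))) ⊆ ω (c 1))
    (h2 : (↑(wordArc W r₂ L) : Set (Sym2 (Site d))) ⊆ ω (c 2)) :
    ∃ i ∈ idxAllT m₁ m₂ m₃ M x v y, ω ∈ triEventL c m₂ m₃ M x v y i := by
  classical
  by_cases hLM : L < M
  · refine ⟨Sum.inl ⟨L, (W, r₁, r₂)⟩, ?_, mem_boxE_of_trail c hW (by omega) (by omega) h0 h1 h2⟩
    simp only [idxAllT, Finset.inl_mem_disjSum, idxExplicitT, baseExplicitT, Finset.mem_filter, Finset.mem_sigma,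
      Finset.mem_product, mem_trailWordsTo, Finset.mem_Ico, triPairsE, Finset.mem_Icc]
    exact ⟨⟨⟨by omega, hLM⟩, ⟨hW, hx⟩, ⟨⟨by omega, by omega⟩, by omega, by omega⟩, hr₁₂⟩, hv, hy⟩
  · replace hLM : M ≤ L := not_lt.1 hLM
    by_cases hr₂M : r₂ < M - m₃
    · refine ⟨Sum.inr (Sum.inl (wordTake W M hLM, r₁, r₂)), ?_,
        mem_boxO_of_trail c hW hLM (by omega) (by omega) hx h0 h1 h2⟩
      simp only [idxAllT, Finset.inr_mem_disjSum, Finset.inl_mem_disjSum, idxOneTailT, baseOneTailT,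
        Finset.mem_filter, Finset.mem_product, mem_trailWords, triPairsO, Finset.mem_Ico]
      exact ⟨⟨hW.wordTake hLM, ⟨⟨hr₁, by omega⟩, by omega, hr₂M⟩, hr₁₂⟩,
        by rw [wordPos_wordTake W hLM (by omega), hv], by rw [wordPos_wordTake W hLM (by omega), hy]⟩
    · replace hr₂M : M - m₃ ≤ r₂ := not_lt.1 hr₂M
      by_cases hr₁M : r₁ < M - (m₂ + m₃)
      · have hMm : M - m₃ ≤ L := by omega
        refine ⟨Sum.inr (Sum.inr (Sum.inl ((wordTake W (M - m₃) hMm, r₁), wordSeg W r₂ m₃ hr₂L))), ?_,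
          mem_boxT2_of_trail c hW (by omega) hr₂M hr₂L hMm hy hx h0 h1 h2⟩
        simp only [idxAllT, Finset.inr_mem_disjSum, Finset.inl_mem_disjSum, idxTwoTailT, baseTwoTailT,
          Finset.mem_filter, Finset.mem_product, mem_trailWords, Finset.mem_Ico]
        exact ⟨⟨⟨hW.wordTake hMm, hr₁, hr₁M⟩, hW.wordSeg hr₂L⟩, by rw [wordPos_wordTake W hMm (by omega), hv]⟩
      · replace hr₁M : M - (m₂ + m₃) ≤ r₁ := not_lt.1 hr₁M
        have hML : M - (m₂ + m₃) ≤ L := by omega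
        have hr₁L : r₁ + m₂ ≤ L := by omega
        refine ⟨Sum.inr (Sum.inr (Sum.inr (wordTake W (M - (m₂ + m₃)) hML, wordSeg W r₁ m₂ hr₁L,
          wordSeg W r₂ m₃ hr₂L))), ?_, mem_boxT3_of_trail c hW hr₁M hr₁₂ hr₂L hML hr₁L hv hy hx h0 h1 h2⟩
        simp only [idxAllT, Finset.inr_mem_disjSum, idxThreeTailT, Finset.mem_product, mem_trailWords]
        exact ⟨hW.wordTake hML, hW.wordSeg hr₁L, hW.wordSeg hr₂L⟩

end Extraction

/-! ### E. The measure of each box: independence across configurations × BK within -/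

section MeasureBounds

variable {k : ℕ} (c : Fin 3 → Fin k) (p : unitInterval)

/-- **Explicit box**: `ℙ_p^{⊗k}(box) ≤ p^{r₁} p^{r₂−r₁} p^{L−r₂} = p^L`.
[cite: FitznerVanDerHofstad2016NoBLE, §5.3.2 (5.41) PTRF p. 1098] -/
theorem piReal_boxE_le {L : ℕ} {W : Fin L → Fin d × Bool} (hW : IsTrail W) {r₁ r₂ : ℕ} (hr₁₂ : r₁ ≤ r₂)
    (hr₂L : r₂ ≤ L) :
    (Measure.pi (fun _ : Fin k => bondPercolation (zdGraph d) p)).real (boxOf (piecesE W r₁ r₂) labE c) ≤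
      (p : ℝ) ^ L := by
  classical
  have h := pi_real_pi_disjointOccurrenceList_le_prod (zdGraph d) p (piecesE W r₁ r₂) (c ∘ labE)
    (piecesE_upper W r₁ r₂) (piecesE_finitary W r₁ r₂)
  rw [Fin.prod_univ_three] at h
  simp only [piecesE, Matrix.cons_val] at h
  rw [measureReal_bondsOpen_wordArc p hW (hr₁₂.trans hr₂L), measureReal_bondsOpen_wordArc p hW hr₂L,
    measureReal_bondsOpen_wordArc p hW le_rfl, ← pow_add, ← pow_add,
    show r₁ - 0 + (r₂ - r₁) + (L - r₂) = L by omega] at h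
  exact h

/-- **One-tail box**: `ℙ_p^{⊗k}(box) ≤ p^M τ_p(u(M), x)`. [cite: FitznerVanDerHofstad2016NoBLE, §5.3.2 (5.41) PTRF p. 1098] -/
theorem piReal_boxO_le {M : ℕ} {u : Fin M → Fin d × Bool} (hu : IsTrail u) {r₁ r₂ : ℕ} (hr₁₂ : r₁ ≤ r₂)
    (hr₂M : r₂ ≤ M) (x : Site d) :
    (Measure.pi (fun _ : Fin k => bondPercolation (zdGraph d) p)).real (boxOf (piecesO u r₁ r₂ x) labO c) ≤
      (p : ℝ) ^ M * tau d p (wordPos u M) x := by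
  classical
  have h := pi_real_pi_disjointOccurrenceList_le_prod (zdGraph d) p (piecesO u r₁ r₂ x) (c ∘ labO)
    (piecesO_upper u r₁ r₂ x) (piecesO_finitary u r₁ r₂ x)
  rw [Fin.prod_univ_four] at h
  simp only [piecesO, Matrix.cons_val] at h
  rw [measureReal_bondsOpen_wordArc p hu (hr₁₂.trans hr₂M), measureReal_bondsOpen_wordArc p hu hr₂M,
    measureReal_bondsOpen_wordArc p hu le_rfl, ← tau_def, ← pow_add, ← pow_add,
    show r₁ - 0 + (r₂ - r₁) + (M - r₂) = M by omega] at h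
  exact h

/-- **Two-tail box**: `ℙ_p^{⊗k}(box) ≤ p^{M−m₃} p^{m₃} τ_p(u₁(M−m₃), y) τ_p(y + u₃(m₃), x)`.
[cite: FitznerVanDerHofstad2016NoBLE, §5.3.2 (5.41) PTRF p. 1098] -/
theorem piReal_boxT2_le {M m₃ : ℕ} {u₁ : Fin (M - m₃) → Fin d × Bool} (hu₁ : IsTrail u₁)
    {u₃ : Fin m₃ → Fin d × Bool} (hu₃ : IsTrail u₃) {r₁ : ℕ} (hr₁ : r₁ ≤ M - m₃) (x y : Site d) :
    (Measure.pi (fun _ : Fin k => bondPercolation (zdGraph d) p)).real (boxOf (piecesT2 u₁ r₁ u₃ x y) labT2 c) ≤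
      (p : ℝ) ^ (M - m₃) * (p : ℝ) ^ m₃ * (tau d p (wordPos u₁ (M - m₃)) y * tau d p (y + wordPos u₃ m₃) x) := by
  classical
  have h := pi_real_pi_disjointOccurrenceList_le_prod (zdGraph d) p (piecesT2 u₁ r₁ u₃ x y) (c ∘ labT2)
    (piecesT2_upper u₁ r₁ u₃ x y) (piecesT2_finitary u₁ r₁ u₃ x y)
  rw [Fin.prod_univ_five] at h
  simp only [piecesT2, Matrix.cons_val] at h
  rw [measureReal_bondsOpen_wordArc p hu₁ hr₁, measureReal_bondsOpen_wordArc p hu₁ le_rfl,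
    measureReal_wordOpenAt_of_isTrail p y hu₃, ← tau_def, ← tau_def] at h
  have hpow : (p : ℝ) ^ (r₁ - 0) * (p : ℝ) ^ (M - m₃ - r₁) = (p : ℝ) ^ (M - m₃) := by
    rw [← pow_add, show r₁ - 0 + (M - m₃ - r₁) = M - m₃ by omega]
  calc _ ≤ _ := h
    _ = (p : ℝ) ^ (r₁ - 0) * (p : ℝ) ^ (M - m₃ - r₁) * (p : ℝ) ^ m₃ *
          (tau d p (wordPos u₁ (M - m₃)) y * tau d p (y + wordPos u₃ m₃) x) := by ring
    _ = _ := by rw [hpow]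

/-- **Three-tail box**: `ℙ_p^{⊗k}(box) ≤ p^{M−m₂−m₃} p^{m₂} p^{m₃} τ τ τ`.
[cite: FitznerVanDerHofstad2016NoBLE, §5.3.2 (5.41) PTRF p. 1098] -/
theorem piReal_boxT3_le {M m₂ m₃ : ℕ} {u₁ : Fin (M - (m₂ + m₃)) → Fin d × Bool} (hu₁ : IsTrail u₁)
    {u₂ : Fin m₂ → Fin d × Bool} (hu₂ : IsTrail u₂) {u₃ : Fin m₃ → Fin d × Bool} (hu₃ : IsTrail u₃)
    (x v y : Site d) :
    (Measure.pi (fun _ : Fin k => bondPercolation (zdGraph d) p)).real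
        (boxOf (piecesT3 u₁ u₂ u₃ x v y) labT3 c) ≤
      (p : ℝ) ^ (M - (m₂ + m₃)) * (p : ℝ) ^ m₂ * (p : ℝ) ^ m₃ *
        (tau d p (wordPos u₁ (M - (m₂ + m₃))) v * tau d p (v + wordPos u₂ m₂) y *
          tau d p (y + wordPos u₃ m₃) x) := by
  classical
  have h := pi_real_pi_disjointOccurrenceList_le_prod (zdGraph d) p (piecesT3 u₁ u₂ u₃ x v y) (c ∘ labT3)
    (piecesT3_upper u₁ u₂ u₃ x v y) (piecesT3_finitary u₁ u₂ u₃ x v y)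
  rw [Fin.prod_univ_six] at h
  simp only [piecesT3, Matrix.cons_val] at h
  rw [measureReal_wordOpen_of_isTrail p hu₁, measureReal_wordOpenAt_of_isTrail p v hu₂,
    measureReal_wordOpenAt_of_isTrail p y hu₃, ← tau_def, ← tau_def, ← tau_def] at h
  calc _ ≤ _ := h
    _ = _ := by ring

end MeasureBounds

/-! ### F. The pointwise bound (every configuration assignment) -/

/-- **[FvdH17] (4.17) member `c`, pointwise in `(v, y)`, by extraction** — the same right-hand side as
`diagT_le_extraction` (every `k, c, m₁, m₂, m₃, M, x, v, y, p`).
[cite: FitznerVanDerHofstad2016NoBLE, §5.3.2 (5.41) PTRF p. 1098]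
[cite: FitznerVanDerHofstad2017, §4.2 (4.17) and the display after (4.18) (arXiv:1506.07977v2 p. 36 = EJP p. 33)] -/
theorem diagTL_le_extraction {k : ℕ} (c : Fin 3 → Fin k) (p : unitInterval) (m₁ m₂ m₃ M : ℕ) (x v y : Site d) :
    diagTL d k p c m₁ m₂ m₃ v y x ≤
      (∑ t ∈ idxExplicitT m₁ m₂ m₃ M x v y, (p : ℝ) ^ t.1) +
        (∑ t ∈ idxOneTailT (d := d) m₁ m₂ m₃ M v y, (p : ℝ) ^ M * tau d p (wordPos t.1 M) x) +
          (∑ t ∈ idxTwoTailT (d := d) m₁ m₂ m₃ M v,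
            (p : ℝ) ^ (M - m₃) * (p : ℝ) ^ m₃ *
              (tau d p (wordPos t.1.1 (M - m₃)) y * tau d p (y + wordPos t.2 m₃) x)) +
            ∑ t ∈ idxThreeTailT (d := d) m₂ m₃ M,
              (p : ℝ) ^ (M - (m₂ + m₃)) * (p : ℝ) ^ m₂ * (p : ℝ) ^ m₃ *
                (tau d p (wordPos t.1 (M - (m₂ + m₃))) v * tau d p (v + wordPos t.2.1 m₂) y *
                  tau d p (y + wordPos t.2.2 m₃) x) := by
  classical
  set μ := bondPercolation (zdGraph d) p with hμ
  set ν : Measure (Fin k → BondConfig (Site d)) := Measure.pi (fun _ : Fin k => μ) with hν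
  set T : Set (Fin k → BondConfig (Site d)) := genDisjConnN (triLines c m₁ m₂ m₃ v y x) with hT
  set bad : Set (Fin k → BondConfig (Site d)) :=
    ⋃ j : Fin k, Function.eval j ⁻¹' {ω | ¬ ω ⊆ (zdGraph d).edgeSet} with hbad
  have h0 : μ {ω | ¬ ω ⊆ (zdGraph d).edgeSet} = 0 := by
    have := ProbabilityTheory.setBernoulli_ae_subset (u := (zdGraph d).edgeSet) (p := p)
    rw [Filter.Eventually, mem_ae_iff, Set.compl_setOf] at this
    exact this
  have hbad0 : ν.real bad = 0 := by
    rw [measureReal_def, measure_iUnion_null fun j => ?_, ENNReal.toReal_zero]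
    exact Measure.pi_eval_preimage_null (fun _ : Fin k => μ) h0
  -- the covering
  have hcov : T ⊆ bad ∪ ⋃ i ∈ idxAllT m₁ m₂ m₃ M x v y, triEventL c m₂ m₃ M x v y i := by
    intro ω hω
    by_cases hb : ∀ j, ω j ⊆ (zdGraph d).edgeSet
    · right
      obtain ⟨L, r₁, r₂, W, hW, hr₁, hr₁₂, hr₂L, hv, hy, hx, hW0, hW1, hW2⟩ :=
        exists_trail_of_mem_genDisjConnN_triLines hb hω
      obtain ⟨i, hi, hωi⟩ := mem_triEventL_of_trail c m₁ m₂ m₃ M hW hr₁ hr₁₂ hr₂L hv hy hx hW0 hW1 hW2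
      exact Set.mem_biUnion (Finset.mem_coe.2 hi) hωi
    · left
      obtain ⟨j, hj⟩ := not_forall.1 hb
      exact Set.mem_iUnion.2 ⟨j, hj⟩
  have h1 : diagTL d k p c m₁ m₂ m₃ v y x ≤ ∑ i ∈ idxAllT m₁ m₂ m₃ M x v y, ν.real (triEventL c m₂ m₃ M x v y i) := by
    calc diagTL d k p c m₁ m₂ m₃ v y x = ν.real T := rfl
      _ ≤ ν.real (bad ∪ ⋃ i ∈ idxAllT m₁ m₂ m₃ M x v y, triEventL c m₂ m₃ M x v y i) := measureReal_mono hcov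
      _ ≤ ν.real bad + ν.real (⋃ i ∈ idxAllT m₁ m₂ m₃ M x v y, triEventL c m₂ m₃ M x v y i) :=
          measureReal_union_le _ _
      _ ≤ 0 + ∑ i ∈ idxAllT m₁ m₂ m₃ M x v y, ν.real (triEventL c m₂ m₃ M x v y i) :=
          add_le_add hbad0.le (measureReal_biUnion_finset_le _ _)
      _ = _ := zero_add _
  -- split into the four families and bound each box
  rw [idxAllT, Finset.sum_disjSum, Finset.sum_disjSum, Finset.sum_disjSum] at h1
  have hE : ∑ t ∈ idxExplicitT m₁ m₂ m₃ M x v y, ν.real (triEventL c m₂ m₃ M x v y (Sum.inl t)) ≤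
      ∑ t ∈ idxExplicitT m₁ m₂ m₃ M x v y, (p : ℝ) ^ t.1 := by
    refine Finset.sum_le_sum fun t ht => ?_
    obtain ⟨L, W, r₁, r₂⟩ := t
    simp only [idxExplicitT, baseExplicitT, triPairsE, Finset.mem_filter, Finset.mem_sigma, Finset.mem_product,
      mem_trailWordsTo, Finset.mem_Icc, Finset.mem_Ico] at ht
    exact piReal_boxE_le c p ht.1.2.1.1 (by omega) (by omega)
  have hO : ∑ t ∈ idxOneTailT (d := d) m₁ m₂ m₃ M v y, ν.real (triEventL c m₂ m₃ M x v y (Sum.inr (Sum.inl t))) ≤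
      ∑ t ∈ idxOneTailT (d := d) m₁ m₂ m₃ M v y, (p : ℝ) ^ M * tau d p (wordPos t.1 M) x := by
    refine Finset.sum_le_sum fun t ht => ?_
    obtain ⟨u, r₁, r₂⟩ := t
    simp only [idxOneTailT, baseOneTailT, triPairsO, Finset.mem_filter, Finset.mem_product, mem_trailWords,
      Finset.mem_Ico] at ht
    exact piReal_boxO_le c p ht.1.1 (by omega) (by omega) x
  have hT2 : ∑ t ∈ idxTwoTailT (d := d) m₁ m₂ m₃ M v,
      ν.real (triEventL c m₂ m₃ M x v y (Sum.inr (Sum.inr (Sum.inl t)))) ≤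
      ∑ t ∈ idxTwoTailT (d := d) m₁ m₂ m₃ M v, (p : ℝ) ^ (M - m₃) * (p : ℝ) ^ m₃ *
        (tau d p (wordPos t.1.1 (M - m₃)) y * tau d p (y + wordPos t.2 m₃) x) := by
    refine Finset.sum_le_sum fun t ht => ?_
    obtain ⟨⟨u₁, r₁⟩, u₃⟩ := t
    simp only [idxTwoTailT, baseTwoTailT, Finset.mem_filter, Finset.mem_product, mem_trailWords,
      Finset.mem_Ico] at ht
    exact piReal_boxT2_le c p ht.1.1.1 ht.1.2 (by omega) x y
  have hT3 : ∑ t ∈ idxThreeTailT (d := d) m₂ m₃ M,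
      ν.real (triEventL c m₂ m₃ M x v y (Sum.inr (Sum.inr (Sum.inr t)))) ≤
      ∑ t ∈ idxThreeTailT (d := d) m₂ m₃ M, (p : ℝ) ^ (M - (m₂ + m₃)) * (p : ℝ) ^ m₂ * (p : ℝ) ^ m₃ *
        (tau d p (wordPos t.1 (M - (m₂ + m₃))) v * tau d p (v + wordPos t.2.1 m₂) y *
          tau d p (y + wordPos t.2.2 m₃) x) := by
    refine Finset.sum_le_sum fun t ht => ?_
    obtain ⟨u₁, u₂, u₃⟩ := t
    simp only [idxThreeTailT, Finset.mem_product, mem_trailWords] at ht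
    exact piReal_boxT3_le c p ht.1 ht.2.1 ht.2.2 x v y
  linarith

/-- **The repulsive triangle (4.17) — the maximum over the nine members — pointwise by extraction.**
[cite: FitznerVanDerHofstad2017, §4.2 (4.17) (arXiv:1506.07977v2 p. 36 = EJP p. 33)]
[cite: FitznerVanDerHofstad2016NoBLE, §5.3.2 (5.41) PTRF p. 1098] -/
theorem repTriangle_le_extraction (p : unitInterval) (m₁ m₂ m₃ M : ℕ) (x v y : Site d) :
    repTriangle d p m₁ m₂ m₃ v y x ≤
      (∑ t ∈ idxExplicitT m₁ m₂ m₃ M x v y, (p : ℝ) ^ t.1) +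
        (∑ t ∈ idxOneTailT (d := d) m₁ m₂ m₃ M v y, (p : ℝ) ^ M * tau d p (wordPos t.1 M) x) +
          (∑ t ∈ idxTwoTailT (d := d) m₁ m₂ m₃ M v,
            (p : ℝ) ^ (M - m₃) * (p : ℝ) ^ m₃ *
              (tau d p (wordPos t.1.1 (M - m₃)) y * tau d p (y + wordPos t.2 m₃) x)) +
            ∑ t ∈ idxThreeTailT (d := d) m₂ m₃ M,
              (p : ℝ) ^ (M - (m₂ + m₃)) * (p : ℝ) ^ m₂ * (p : ℝ) ^ m₃ *
                (tau d p (wordPos t.1 (M - (m₂ + m₃))) v * tau d p (v + wordPos t.2.1 m₂) y *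
                  tau d p (y + wordPos t.2.2 m₃) x) :=
  Finset.sup'_le _ _ fun ij _ => diagTL_le_extraction (![0, ij.1, ij.2]) p m₁ m₂ m₃ M x v y

/-! ### G. Summation over `(v, y)`: stated once for any pointwise-dominated `D` -/

/-- **[NoBLE17] (5.41) summed over finite sets `v ∈ S₁`, `y ∈ S₂`, for ANY `D(v,y)` obeying the pointwise extraction
bound** (the bookkeeping of `sum_sum_diagT_le_extraction`, abstracted from `diagT`).
[cite: FitznerVanDerHofstad2016NoBLE, §5.3.2 (5.41) PTRF p. 1098] -/
theorem sum_sum_le_extractionT_of_pointwise (p : unitInterval) (m₁ m₂ m₃ M : ℕ) (x : Site d)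
    (S₁ S₂ : Finset (Site d)) {D : Site d → Site d → ℝ}
    (hpt : ∀ v ∈ S₁, ∀ y ∈ S₂, D v y ≤
      (∑ t ∈ idxExplicitT m₁ m₂ m₃ M x v y, (p : ℝ) ^ t.1) +
        (∑ t ∈ idxOneTailT (d := d) m₁ m₂ m₃ M v y, (p : ℝ) ^ M * tau d p (wordPos t.1 M) x) +
          (∑ t ∈ idxTwoTailT (d := d) m₁ m₂ m₃ M v,
            (p : ℝ) ^ (M - m₃) * (p : ℝ) ^ m₃ *
              (tau d p (wordPos t.1.1 (M - m₃)) y * tau d p (y + wordPos t.2 m₃) x)) +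
            ∑ t ∈ idxThreeTailT (d := d) m₂ m₃ M,
              (p : ℝ) ^ (M - (m₂ + m₃)) * (p : ℝ) ^ m₂ * (p : ℝ) ^ m₃ *
                (tau d p (wordPos t.1 (M - (m₂ + m₃))) v * tau d p (v + wordPos t.2.1 m₂) y *
                  tau d p (y + wordPos t.2.2 m₃) x)) :
    ∑ v ∈ S₁, ∑ y ∈ S₂, D v y ≤
      (∑ L ∈ Finset.Ico (m₁ + m₂ + m₃) M,
          ((triPairsE m₁ m₂ m₃ L).card : ℝ) * ((trailWordsTo d L x).card : ℝ) * (p : ℝ) ^ L) +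
        ((triPairsO m₁ m₂ m₃ M).card : ℝ) * ((p : ℝ) ^ M * ∑ u ∈ trailWords d M, tau d p 0 (x - wordPos u M)) +
          ((Finset.Ico m₁ (M - (m₂ + m₃))).card : ℝ) * ((p : ℝ) ^ (M - m₃) * (p : ℝ) ^ m₃ *
            ∑ uu ∈ idxTwoTail (d := d) m₃ M,
              ∑ y ∈ S₂, tau d p (wordPos uu.1 (M - m₃)) y * tau d p (y + wordPos uu.2 m₃) x) +
            (p : ℝ) ^ (M - (m₂ + m₃)) * (p : ℝ) ^ m₂ * (p : ℝ) ^ m₃ *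
              ∑ t ∈ idxThreeTailT (d := d) m₂ m₃ M, ∑ v ∈ S₁, ∑ y ∈ S₂,
                tau d p (wordPos t.1 (M - (m₂ + m₃))) v * tau d p (v + wordPos t.2.1 m₂) y *
                  tau d p (y + wordPos t.2.2 m₃) x := by
  classical
  have hp0 : 0 ≤ (p : ℝ) := p.2.1
  -- abbreviations for the four summands of the pointwise bound
  set fE : (Σ L : ℕ, (Fin L → Fin d × Bool) × ℕ × ℕ) → ℝ := fun t => (p : ℝ) ^ t.1 with hfE
  set fO : ((Fin M → Fin d × Bool) × ℕ × ℕ) → ℝ := fun t => (p : ℝ) ^ M * tau d p (wordPos t.1 M) x with hfO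
  set fT : Site d → (((Fin (M - m₃) → Fin d × Bool) × ℕ) × (Fin m₃ → Fin d × Bool)) → ℝ := fun y t =>
    (p : ℝ) ^ (M - m₃) * (p : ℝ) ^ m₃ * (tau d p (wordPos t.1.1 (M - m₃)) y * tau d p (y + wordPos t.2 m₃) x)
    with hfT
  set f3 : Site d → Site d →
      ((Fin (M - (m₂ + m₃)) → Fin d × Bool) × (Fin m₂ → Fin d × Bool) × (Fin m₃ → Fin d × Bool)) → ℝ :=
    fun v y t => (p : ℝ) ^ (M - (m₂ + m₃)) * (p : ℝ) ^ m₂ * (p : ℝ) ^ m₃ *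
      (tau d p (wordPos t.1 (M - (m₂ + m₃))) v * tau d p (v + wordPos t.2.1 m₂) y * tau d p (y + wordPos t.2.2 m₃) x)
    with hf3
  have hsum : ∑ v ∈ S₁, ∑ y ∈ S₂, D v y ≤ ∑ v ∈ S₁, ∑ y ∈ S₂,
      ((∑ t ∈ idxExplicitT m₁ m₂ m₃ M x v y, fE t) + (∑ t ∈ idxOneTailT (d := d) m₁ m₂ m₃ M v y, fO t) +
        (∑ t ∈ idxTwoTailT (d := d) m₁ m₂ m₃ M v, fT y t) + ∑ t ∈ idxThreeTailT (d := d) m₂ m₃ M, f3 v y t) :=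
    Finset.sum_le_sum fun v hv => Finset.sum_le_sum fun y hy => hpt v hv y hy
  simp only [Finset.sum_add_distrib] at hsum
  refine hsum.trans (add_le_add (add_le_add (add_le_add ?_ ?_) ?_) (le_of_eq ?_))
  · -- explicit family: drop the two filter keys, then count
    calc ∑ v ∈ S₁, ∑ y ∈ S₂, ∑ t ∈ idxExplicitT m₁ m₂ m₃ M x v y, fE t
        ≤ ∑ t ∈ baseExplicitT m₁ m₂ m₃ M x, fE t :=
          sum_sum_sum_filter_le S₁ S₂ (baseExplicitT m₁ m₂ m₃ M x) (fun t => wordPos t.2.1 t.2.2.1)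
            (fun t => wordPos t.2.1 t.2.2.2) (fun t _ => pow_nonneg hp0 _)
      _ = ∑ L ∈ Finset.Ico (m₁ + m₂ + m₃) M,
            ((triPairsE m₁ m₂ m₃ L).card : ℝ) * ((trailWordsTo d L x).card : ℝ) * (p : ℝ) ^ L := by
          rw [baseExplicitT, Finset.sum_sigma]
          refine Finset.sum_congr rfl fun L _ => ?_
          rw [hfE]
          simp only [Finset.sum_const, Finset.card_product, nsmul_eq_mul, Nat.cast_mul]
          ring
  · -- one-tail family
    calc ∑ v ∈ S₁, ∑ y ∈ S₂, ∑ t ∈ idxOneTailT (d := d) m₁ m₂ m₃ M v y, fO t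
        ≤ ∑ t ∈ baseOneTailT (d := d) m₁ m₂ m₃ M, fO t :=
          sum_sum_sum_filter_le S₁ S₂ (baseOneTailT (d := d) m₁ m₂ m₃ M) (fun t => wordPos t.1 t.2.1)
            (fun t => wordPos t.1 t.2.2) (fun t _ => mul_nonneg (pow_nonneg hp0 M) (tau_nonneg p _ _))
      _ = ((triPairsO m₁ m₂ m₃ M).card : ℝ) *
            ((p : ℝ) ^ M * ∑ u ∈ trailWords d M, tau d p 0 (x - wordPos u M)) := by
          rw [baseOneTailT, Finset.sum_product, Finset.mul_sum, Finset.mul_sum]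
          refine Finset.sum_congr rfl fun u _ => ?_
          rw [hfO]
          simp only [Finset.sum_const, nsmul_eq_mul, tau_eq_tau_zero_sub p (wordPos u M) x]
  · -- two-tail family: exchange `y` with the index sum, drop the `v` filter key, then count `r₁`
    calc ∑ v ∈ S₁, ∑ y ∈ S₂, ∑ t ∈ idxTwoTailT (d := d) m₁ m₂ m₃ M v, fT y t
        = ∑ v ∈ S₁, ∑ t ∈ idxTwoTailT (d := d) m₁ m₂ m₃ M v, ∑ y ∈ S₂, fT y t :=
          Finset.sum_congr rfl fun v _ => Finset.sum_comm
      _ ≤ ∑ t ∈ baseTwoTailT (d := d) m₁ m₂ m₃ M, ∑ y ∈ S₂, fT y t :=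
          sum_sum_filter_le S₁ (baseTwoTailT (d := d) m₁ m₂ m₃ M) (fun t => wordPos t.1.1 t.1.2)
            (fun t _ => Finset.sum_nonneg fun y _ => by
              rw [hfT]
              exact mul_nonneg (mul_nonneg (pow_nonneg hp0 _) (pow_nonneg hp0 _))
                (mul_nonneg (tau_nonneg p _ _) (tau_nonneg p _ _)))
      _ = ((Finset.Ico m₁ (M - (m₂ + m₃))).card : ℝ) * ((p : ℝ) ^ (M - m₃) * (p : ℝ) ^ m₃ *
            ∑ uu ∈ idxTwoTail (d := d) m₃ M,
              ∑ y ∈ S₂, tau d p (wordPos uu.1 (M - m₃)) y * tau d p (y + wordPos uu.2 m₃) x) := by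
          rw [baseTwoTailT, idxTwoTail, Finset.sum_product, Finset.sum_product, Finset.sum_product, Finset.mul_sum,
            Finset.mul_sum]
          refine Finset.sum_congr rfl fun u₁ _ => ?_
          rw [Finset.mul_sum, Finset.mul_sum, Finset.sum_comm]
          refine Finset.sum_congr rfl fun u₃ _ => ?_
          simp only [hfT]
          rw [Finset.sum_const, nsmul_eq_mul]
          congr 1
          rw [Finset.mul_sum]
  · -- three-tail family: exchange the sums
    rw [Finset.mul_sum]
    calc ∑ v ∈ S₁, ∑ y ∈ S₂, ∑ t ∈ idxThreeTailT (d := d) m₂ m₃ M, f3 v y t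
        = ∑ v ∈ S₁, ∑ t ∈ idxThreeTailT (d := d) m₂ m₃ M, ∑ y ∈ S₂, f3 v y t :=
          Finset.sum_congr rfl fun v _ => Finset.sum_comm
      _ = ∑ t ∈ idxThreeTailT (d := d) m₂ m₃ M, ∑ v ∈ S₁, ∑ y ∈ S₂, f3 v y t := Finset.sum_comm
      _ = _ := by
          refine Finset.sum_congr rfl fun t _ => ?_
          rw [hf3, Finset.mul_sum]
          refine Finset.sum_congr rfl fun v _ => ?_
          rw [Finset.mul_sum]

/-- **Conversion of the multiplicities to binomial coefficients** (as `sum_sum_diagT_le_extraction_choose`):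
`#triPairsE(L) = C(L+2−m_{1,3},2)` for `L ≥ m_{1,3}`, `#triPairsO(M) = C(M+1−m_{1,3},2)`, `#Ico m₁ (M−m_{2,3}) =
M − m_{1,3}`. [cite: FitznerVanDerHofstad2016NoBLE, §5.3.2 (5.41) PTRF p. 1098] -/
theorem le_extractionT_choose_of_le (p : unitInterval) (m₁ m₂ m₃ M : ℕ) (x : Site d) (S₁ S₂ : Finset (Site d))
    {a : ℝ}
    (h : a ≤
      (∑ L ∈ Finset.Ico (m₁ + m₂ + m₃) M,
          ((triPairsE m₁ m₂ m₃ L).card : ℝ) * ((trailWordsTo d L x).card : ℝ) * (p : ℝ) ^ L) +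
        ((triPairsO m₁ m₂ m₃ M).card : ℝ) * ((p : ℝ) ^ M * ∑ u ∈ trailWords d M, tau d p 0 (x - wordPos u M)) +
          ((Finset.Ico m₁ (M - (m₂ + m₃))).card : ℝ) * ((p : ℝ) ^ (M - m₃) * (p : ℝ) ^ m₃ *
            ∑ uu ∈ idxTwoTail (d := d) m₃ M,
              ∑ y ∈ S₂, tau d p (wordPos uu.1 (M - m₃)) y * tau d p (y + wordPos uu.2 m₃) x) +
            (p : ℝ) ^ (M - (m₂ + m₃)) * (p : ℝ) ^ m₂ * (p : ℝ) ^ m₃ *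
              ∑ t ∈ idxThreeTailT (d := d) m₂ m₃ M, ∑ v ∈ S₁, ∑ y ∈ S₂,
                tau d p (wordPos t.1 (M - (m₂ + m₃))) v * tau d p (v + wordPos t.2.1 m₂) y *
                  tau d p (y + wordPos t.2.2 m₃) x) :
    a ≤
      (∑ L ∈ Finset.Ico (m₁ + m₂ + m₃) M,
          (((L + 2 - (m₁ + m₂ + m₃)).choose 2 : ℕ) : ℝ) * ((trailWordsTo d L x).card : ℝ) * (p : ℝ) ^ L) +
        (((M + 1 - (m₁ + m₂ + m₃)).choose 2 : ℕ) : ℝ) *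
            ((p : ℝ) ^ M * ∑ u ∈ trailWords d M, tau d p 0 (x - wordPos u M)) +
          ((M - (m₁ + m₂ + m₃) : ℕ) : ℝ) * ((p : ℝ) ^ (M - m₃) * (p : ℝ) ^ m₃ *
            ∑ uu ∈ idxTwoTail (d := d) m₃ M,
              ∑ y ∈ S₂, tau d p (wordPos uu.1 (M - m₃)) y * tau d p (y + wordPos uu.2 m₃) x) +
            (p : ℝ) ^ (M - (m₂ + m₃)) * (p : ℝ) ^ m₂ * (p : ℝ) ^ m₃ *
              ∑ t ∈ idxThreeTailT (d := d) m₂ m₃ M, ∑ v ∈ S₁, ∑ y ∈ S₂,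
                tau d p (wordPos t.1 (M - (m₂ + m₃))) v * tau d p (v + wordPos t.2.1 m₂) y *
                  tau d p (y + wordPos t.2.2 m₃) x := by
  have hE : (∑ L ∈ Finset.Ico (m₁ + m₂ + m₃) M,
      ((triPairsE m₁ m₂ m₃ L).card : ℝ) * ((trailWordsTo d L x).card : ℝ) * (p : ℝ) ^ L) =
      ∑ L ∈ Finset.Ico (m₁ + m₂ + m₃) M,
        (((L + 2 - (m₁ + m₂ + m₃)).choose 2 : ℕ) : ℝ) * ((trailWordsTo d L x).card : ℝ) * (p : ℝ) ^ L :=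
    Finset.sum_congr rfl fun L hL => by rw [card_triPairsE_eq_choose (Finset.mem_Ico.1 hL).1]
  rw [hE, card_triPairsO_eq_choose, card_triTwoTail_eq] at h
  exact h

/-! ### H. The summed bounds for every member and for the maximum; the slot form -/

/-- **[NoBLE17] (5.41) for the `(4.17)` member on configurations `c`, summed over `v ∈ S₁`, `y ∈ S₂`** — the same
right-hand side as `sum_sum_diagT_le_extraction`. [cite: FitznerVanDerHofstad2016NoBLE, §5.3.2 (5.41) PTRF p. 1098]
[cite: FitznerVanDerHofstad2017, §4.2 (4.17) and the display after (4.18) (arXiv:1506.07977v2 p. 36 = EJP p. 33)] -/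
theorem sum_sum_diagTL_le_extraction {k : ℕ} (c : Fin 3 → Fin k) (p : unitInterval) (m₁ m₂ m₃ M : ℕ)
    (x : Site d) (S₁ S₂ : Finset (Site d)) :
    ∑ v ∈ S₁, ∑ y ∈ S₂, diagTL d k p c m₁ m₂ m₃ v y x ≤
      (∑ L ∈ Finset.Ico (m₁ + m₂ + m₃) M,
          ((triPairsE m₁ m₂ m₃ L).card : ℝ) * ((trailWordsTo d L x).card : ℝ) * (p : ℝ) ^ L) +
        ((triPairsO m₁ m₂ m₃ M).card : ℝ) * ((p : ℝ) ^ M * ∑ u ∈ trailWords d M, tau d p 0 (x - wordPos u M)) +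
          ((Finset.Ico m₁ (M - (m₂ + m₃))).card : ℝ) * ((p : ℝ) ^ (M - m₃) * (p : ℝ) ^ m₃ *
            ∑ uu ∈ idxTwoTail (d := d) m₃ M,
              ∑ y ∈ S₂, tau d p (wordPos uu.1 (M - m₃)) y * tau d p (y + wordPos uu.2 m₃) x) +
            (p : ℝ) ^ (M - (m₂ + m₃)) * (p : ℝ) ^ m₂ * (p : ℝ) ^ m₃ *
              ∑ t ∈ idxThreeTailT (d := d) m₂ m₃ M, ∑ v ∈ S₁, ∑ y ∈ S₂,
                tau d p (wordPos t.1 (M - (m₂ + m₃))) v * tau d p (v + wordPos t.2.1 m₂) y *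
                  tau d p (y + wordPos t.2.2 m₃) x :=
  sum_sum_le_extractionT_of_pointwise p m₁ m₂ m₃ M x S₁ S₂ fun v _ y _ => diagTL_le_extraction c p m₁ m₂ m₃ M x v y

/-- **[FvdH17] (4.17) — the repulsive triangle (maximum over the nine members) — by extraction, summed over
`v ∈ S₁`, `y ∈ S₂`**, right-hand side of `sum_sum_diagT_le_extraction`.
[cite: FitznerVanDerHofstad2017, §4.2 (4.17) (arXiv:1506.07977v2 p. 36 = EJP p. 33)]
[cite: FitznerVanDerHofstad2016NoBLE, §5.3.2 (5.41) PTRF p. 1098] -/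
theorem sum_sum_repTriangle_le_extraction (p : unitInterval) (m₁ m₂ m₃ M : ℕ) (x : Site d)
    (S₁ S₂ : Finset (Site d)) :
    ∑ v ∈ S₁, ∑ y ∈ S₂, repTriangle d p m₁ m₂ m₃ v y x ≤
      (∑ L ∈ Finset.Ico (m₁ + m₂ + m₃) M,
          ((triPairsE m₁ m₂ m₃ L).card : ℝ) * ((trailWordsTo d L x).card : ℝ) * (p : ℝ) ^ L) +
        ((triPairsO m₁ m₂ m₃ M).card : ℝ) * ((p : ℝ) ^ M * ∑ u ∈ trailWords d M, tau d p 0 (x - wordPos u M)) +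
          ((Finset.Ico m₁ (M - (m₂ + m₃))).card : ℝ) * ((p : ℝ) ^ (M - m₃) * (p : ℝ) ^ m₃ *
            ∑ uu ∈ idxTwoTail (d := d) m₃ M,
              ∑ y ∈ S₂, tau d p (wordPos uu.1 (M - m₃)) y * tau d p (y + wordPos uu.2 m₃) x) +
            (p : ℝ) ^ (M - (m₂ + m₃)) * (p : ℝ) ^ m₂ * (p : ℝ) ^ m₃ *
              ∑ t ∈ idxThreeTailT (d := d) m₂ m₃ M, ∑ v ∈ S₁, ∑ y ∈ S₂,
                tau d p (wordPos t.1 (M - (m₂ + m₃))) v * tau d p (v + wordPos t.2.1 m₂) y *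
                  tau d p (y + wordPos t.2.2 m₃) x :=
  sum_sum_le_extractionT_of_pointwise p m₁ m₂ m₃ M x S₁ S₂ fun v _ y _ => repTriangle_le_extraction p m₁ m₂ m₃ M x v y

/-- **(4.17) by extraction with binomial multiplicities** (`C(L+2−m_{1,3},2)`, `C(M+1−m_{1,3},2)`, `M−m_{1,3}`, `1`).
[cite: FitznerVanDerHofstad2016NoBLE, §5.3.2 (5.41) PTRF p. 1098]
[cite: FitznerVanDerHofstad2017, §4.2 (4.17) (arXiv:1506.07977v2 p. 36 = EJP p. 33)] -/
theorem sum_sum_repTriangle_le_extraction_choose (p : unitInterval) (m₁ m₂ m₃ M : ℕ) (x : Site d)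
    (S₁ S₂ : Finset (Site d)) :
    ∑ v ∈ S₁, ∑ y ∈ S₂, repTriangle d p m₁ m₂ m₃ v y x ≤
      (∑ L ∈ Finset.Ico (m₁ + m₂ + m₃) M,
          (((L + 2 - (m₁ + m₂ + m₃)).choose 2 : ℕ) : ℝ) * ((trailWordsTo d L x).card : ℝ) * (p : ℝ) ^ L) +
        (((M + 1 - (m₁ + m₂ + m₃)).choose 2 : ℕ) : ℝ) *
            ((p : ℝ) ^ M * ∑ u ∈ trailWords d M, tau d p 0 (x - wordPos u M)) +
          ((M - (m₁ + m₂ + m₃) : ℕ) : ℝ) * ((p : ℝ) ^ (M - m₃) * (p : ℝ) ^ m₃ *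
            ∑ uu ∈ idxTwoTail (d := d) m₃ M,
              ∑ y ∈ S₂, tau d p (wordPos uu.1 (M - m₃)) y * tau d p (y + wordPos uu.2 m₃) x) +
            (p : ℝ) ^ (M - (m₂ + m₃)) * (p : ℝ) ^ m₂ * (p : ℝ) ^ m₃ *
              ∑ t ∈ idxThreeTailT (d := d) m₂ m₃ M, ∑ v ∈ S₁, ∑ y ∈ S₂,
                tau d p (wordPos t.1 (M - (m₂ + m₃))) v * tau d p (v + wordPos t.2.1 m₂) y *
                  tau d p (y + wordPos t.2.2 m₃) x :=
  le_extractionT_choose_of_le p m₁ m₂ m₃ M x S₁ S₂ (sum_sum_repTriangle_le_extraction p m₁ m₂ m₃ M x S₁ S₂)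

/-- **The `(4.17)` member on configurations `c` at abstract remainder-kernel slots** (`d ≥ 2`, `p < p_c`,
`m₂ + m₃ ≤ M`, `x ∈ X`, `R₁, R₂, R₃` valid remainder constants):
`Σ_{v∈S₁} Σ_{y∈S₂} ℙ^{⊗k}(member c) ≤ Σ_L C(L+2−m,2) a_L(x) p^L + C(M+1−m,2) p^M Γ̄₂ R₁ + (M−m) p^M Γ̄₂² R₂ + p^M Γ̄₂³ R₃`.
[cite: FitznerVanDerHofstad2016NoBLE, §5.3.2 (5.41) p. 1098; first display p. 1097]
[cite: FitznerVanDerHofstad2017, §4.2 (4.17); notebook Percolation.nb cells 11, 12] -/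
theorem sum_sum_diagTL_le_slots (hd : 2 ≤ d) {k : ℕ} (c : Fin 3 → Fin k) (p : unitInterval)
    (hp : p < criticalProbI d) {m₁ m₂ m₃ M : ℕ} (hm : m₂ + m₃ ≤ M) {x : Site d} {X : Set (Site d)} (hx : x ∈ X)
    {R₁ R₂ R₃ : ℝ} (hR₁ : IsRemKernelConst d [M] X R₁) (hR₂ : IsRemKernelConst d [M - m₃, m₃] X R₂)
    (hR₃ : IsRemKernelConst d [M - (m₂ + m₃), m₂, m₃] X R₃) (S₁ S₂ : Finset (Site d)) :
    ∑ v ∈ S₁, ∑ y ∈ S₂, diagTL d k p c m₁ m₂ m₃ v y x ≤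
      (∑ L ∈ Finset.Ico (m₁ + m₂ + m₃) M,
          (((L + 2 - (m₁ + m₂ + m₃)).choose 2 : ℕ) : ℝ) * ((trailWordsTo d L x).card : ℝ) * (p : ℝ) ^ L) +
        (((M + 1 - (m₁ + m₂ + m₃)).choose 2 : ℕ) : ℝ) * ((p : ℝ) ^ M * (nobleSup2 d p * R₁)) +
          ((M - (m₁ + m₂ + m₃) : ℕ) : ℝ) * ((p : ℝ) ^ M * (nobleSup2 d p ^ 2 * R₂)) +
            (p : ℝ) ^ M * (nobleSup2 d p ^ 3 * R₃) :=
  sum_sum_le_repTriangle_slots (D := fun v y => diagTL d k p c m₁ m₂ m₃ v y x)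
    (fun S₁ S₂ => le_extractionT_choose_of_le p m₁ m₂ m₃ M x S₁ S₂
      (sum_sum_diagTL_le_extraction c p m₁ m₂ m₃ M x S₁ S₂))
    hd hp hm hx hR₁ hR₂ hR₃ S₁ S₂

/-- **[FvdH17] (4.17), the repulsive triangle `𝓣_{m₁,m₂,m₃}(v,y,x)` (maximum over the nine members on up to three
independent configurations), at abstract remainder-kernel slots** (`d ≥ 2`, `p < p_c`, `m₂ + m₃ ≤ M`, `x ∈ X`):
`Σ_{v∈S₁} Σ_{y∈S₂} 𝓣(v,y,x) ≤ Σ_L C(L+2−m,2) a_L(x) p^L + C(M+1−m,2) p^M Γ̄₂ R₁ + (M−m) p^M Γ̄₂² R₂ + p^M Γ̄₂³ R₃`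
— (5.41) with each tail `(2dμ̄)^M (D^{⋆M}⋆G^{⋆n})(x)` a slot; cells 11/12 of `Percolation.nb`.
[cite: FitznerVanDerHofstad2017, §4.2 (4.17) (arXiv:1506.07977v2 p. 36 = EJP p. 33); notebook Percolation.nb cells 11, 12]
[cite: FitznerVanDerHofstad2016NoBLE, §5.3.2 (5.41) p. 1098; first display p. 1097] -/
theorem sum_sum_repTriangle_le_slots (hd : 2 ≤ d) (p : unitInterval) (hp : p < criticalProbI d)
    {m₁ m₂ m₃ M : ℕ} (hm : m₂ + m₃ ≤ M) {x : Site d} {X : Set (Site d)} (hx : x ∈ X) {R₁ R₂ R₃ : ℝ}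
    (hR₁ : IsRemKernelConst d [M] X R₁) (hR₂ : IsRemKernelConst d [M - m₃, m₃] X R₂)
    (hR₃ : IsRemKernelConst d [M - (m₂ + m₃), m₂, m₃] X R₃) (S₁ S₂ : Finset (Site d)) :
    ∑ v ∈ S₁, ∑ y ∈ S₂, repTriangle d p m₁ m₂ m₃ v y x ≤
      (∑ L ∈ Finset.Ico (m₁ + m₂ + m₃) M,
          (((L + 2 - (m₁ + m₂ + m₃)).choose 2 : ℕ) : ℝ) * ((trailWordsTo d L x).card : ℝ) * (p : ℝ) ^ L) +
        (((M + 1 - (m₁ + m₂ + m₃)).choose 2 : ℕ) : ℝ) * ((p : ℝ) ^ M * (nobleSup2 d p * R₁)) +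
          ((M - (m₁ + m₂ + m₃) : ℕ) : ℝ) * ((p : ℝ) ^ M * (nobleSup2 d p ^ 2 * R₂)) +
            (p : ℝ) ^ M * (nobleSup2 d p ^ 3 * R₃) :=
  sum_sum_le_repTriangle_slots (D := fun v y => repTriangle d p m₁ m₂ m₃ v y x)
    (sum_sum_repTriangle_le_extraction_choose p m₁ m₂ m₃ M x) hd hp hm hx hR₁ hR₂ hR₃ S₁ S₂



end Literature.Probability.FitznerVanDerHofstad2017

end
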